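import Summits.CriticalPhenomena.PercolationContinuityZ3.Theses.PercCriticalCaps
import Summits.CriticalPhenomena.PercolationContinuityZ3.Cruxes.FreeBoxSparse.Lines.axis_fold_linear_depth_bgn
import Literature.Probability.Percolation.CriticalOneArmBKLowerBound
import Literature.Probability.Percolation.TreeGraphBound
import Literature.Probability.Percolation.RSW
import Literature.Probability.Percolation.PercolationProofs

/-!
# Census lemmas for the crux `CapAtCriticality` (stmt-CriticalPhenomena-7510, route PercCriticalCaps)

Crux-strategist `cstrat-stmt-CriticalPhenomena-7510-r1` (planner), 2026-08-17.  BC2-REDIRECT audit of the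
deciding crux

  `CapAtCriticality :  ∀ᵐ ω ∂P_{p_c(ℤ³)},  {t > 0 : t e₀ ↔ {x₀ = 0}}  is finite`.

This file TYPES the candidate pieces of every decomposition recorded in `STRATEGY-CENSUS.md` and
kernel-checks the facts the census verdicts rest on:

* `theta_le_six_mul_real_hitAt` : `θ(p) ≤ 6 · P_p(m e₀ ↔ plane)` for every `p`, `m` (face symmetry) —
  hence EVERY "smallness" piece (hit/arm probabilities summable, or `→ 0` along any subsequence) already
  implies the conjunct `θ(p_c) = 0` (`summit_of_hitProb_tendsto_zero`, `summit_of_hitProbSummable`,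
  `summit_of_dyadicHitSummable`, `summit_of_oneArmSummableZ3`): such pieces FAIL criterion (c).
* `not_hitProbSummable`, `not_oneArmSummableZ3` : on `ℤ³`, `Σ_t P_{p_c}(t e₀ ↔ plane) = ∞` and
  `Σ_n π_{p_c}(n) = ∞` (from the landed `exists_oneArmProb_criticalProbI_three_lower`, `π_{p_c}(n) ≥ c/n`):
  the first-moment / summable-one-arm engines for the crux are DEAD on `ℤ³` (pieces rigorously false).
* the seams of the "partition" split (D5), the "zero–one" split (D1), the "run-end" split (D6) and the
  "bridging clusters" split (D8) are proved, to exhibit exactly how thin they are.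

No `sorry`.  Namespace of a crux workfile.
-/

noncomputable section

open MeasureTheory Filter Topology
open Literature.Probability.Percolation Literature.Probability.LatticeModels
open Summit.CriticalPhenomena.PercolationContinuityZ3.Cruxes.FreeBoxSparse.AxisFoldLinearDepthBgn
  (faceEvent siteToBoundary_subset_iUnion_faceEvent real_faceEvent_eq)

namespace Summit.CriticalPhenomena.PercolationContinuityZ3.Cruxes.CapAtCriticality.Census

/-! ## §0 Vocabulary -/

/-- The critical bond measure on `ℤ³`. [folklore] -/
abbrev μc : Measure (BondConfig (Site 3)) := bondPercolation (zdGraph 3) (criticalProbI 3)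

/-- The hit event at height `t`: `t e₀ ↔ {x₀ = 0}`. [folklore] -/
def hitAt (t : ℤ) : Set (BondConfig (Site 3)) :=
  {ω | ∃ y : Site 3, y 0 = 0 ∧ ω ∈ openConn (Pi.single 0 t : Site 3) y}

/-- The hit set of a configuration: the positive heights that are hits. [folklore] -/
def hitSet (ω : BondConfig (Site 3)) : Set ℤ := {t | 0 < t ∧ ω ∈ hitAt t}

/-- The crux, by name, is `a.s. the hit set is finite`. [folklore] -/
theorem cap_iff : Theses.PercCriticalCaps.CapAtCriticality ↔ ∀ᵐ ω ∂μc, (hitSet ω).Finite := Iff.rfl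

/-- The conjunct, by name, is `θ_{ℤ³}(p_c) = 0`. [folklore] -/
theorem summit_iff :
    _root_.PercolationContinuityZ3 ↔ theta (zdGraph 3) (0 : Site 3) (criticalProbI 3) = 0 :=
  Iff.rfl

/-! ## §1 The comparison `π_p(m) ≤ 6 · P_p(hit at m)` and `θ(p) ≤ 6 · P_p(hit at m)` -/

/-- The bottom face event of `Λ_m`, translated up by `m e₀`, lies inside the hit event at height `m`.
[folklore] -/
theorem real_faceEvent_neg_le_real_hitAt (p : unitInterval) (m : ℕ) :
    (bondPercolation (zdGraph 3) p).real (faceEvent m 0 (-1)) ≤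
      (bondPercolation (zdGraph 3) p).real (hitAt m) := by
  have hshift := real_openCrossing_shift p (Pi.single 0 (m : ℤ) : Site 3) (↑(box 3 m) : Set (Site 3)) {0}
    {y : Site 3 | y ∈ box 3 m ∧ y 0 = (((-1 : ℤˣ) : ℤ)) * m}
  unfold faceEvent
  rw [← hshift]
  refine measureReal_mono ?_ (measure_ne_top _ _)
  rintro ω ⟨x, hx, y, hy, hω⟩
  obtain ⟨x', hx', rfl⟩ := hx
  obtain ⟨y', ⟨-, hy'0⟩, rfl⟩ := hy
  rw [Set.mem_singleton_iff] at hx'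
  subst hx'
  refine ⟨y' + Pi.single 0 (m : ℤ), ?_, ?_⟩
  · show y' 0 + (Pi.single (0 : Fin 3) (m : ℤ) : Site 3) 0 = 0
    rw [hy'0]
    simp
  · have h := openConnIn_subset_openConn _ _ _ hω
    simpa using h

/-- **`π_p(m) ≤ 6 · P_p(m e₀ ↔ plane)`** for every `p` and `m`: the one-arm event is the union of the six
face events, which are equiprobable under the cube group fixing `0`, and the bottom one translates into
the hit event. [folklore] -/
theorem oneArmProb_le_six_mul_real_hitAt (p : unitInterval) (m : ℕ) :
    oneArmProb 3 p m ≤ 6 * (bondPercolation (zdGraph 3) p).real (hitAt m) := by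
  calc oneArmProb 3 p m = (bondPercolation (zdGraph 3) p).real (siteToBoundary 3 m) := rfl
    _ ≤ (bondPercolation (zdGraph 3) p).real (⋃ q : Fin 3 × ℤˣ, faceEvent m q.1 q.2) :=
        measureReal_mono (siteToBoundary_subset_iUnion_faceEvent m) (measure_ne_top _ _)
    _ ≤ ∑ q : Fin 3 × ℤˣ, (bondPercolation (zdGraph 3) p).real (faceEvent m q.1 q.2) :=
        measureReal_iUnion_fintype_le _
    _ = ∑ _q : Fin 3 × ℤˣ, (bondPercolation (zdGraph 3) p).real (faceEvent m 0 (-1)) :=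
        Finset.sum_congr rfl fun q _ => by
          rw [real_faceEvent_eq p m q.1 q.2, ← real_faceEvent_eq p m 0 (-1)]
    _ = 6 * (bondPercolation (zdGraph 3) p).real (faceEvent m 0 (-1)) := by
        rw [Finset.sum_const, nsmul_eq_mul]
        norm_num [Fintype.card_units_int]
    _ ≤ 6 * (bondPercolation (zdGraph 3) p).real (hitAt m) := by
        have := real_faceEvent_neg_le_real_hitAt p m
        linarith

/-- **`θ(p) ≤ 6 · P_p(m e₀ ↔ plane)`** for every `p` and `m ≥ 0`. [folklore] -/
theorem theta_le_six_mul_real_hitAt (p : unitInterval) (m : ℕ) :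
    theta (zdGraph 3) 0 p ≤ 6 * (bondPercolation (zdGraph 3) p).real (hitAt m) :=
  (DCT16.theta_le_real_siteToBoundary p m).trans (oneArmProb_le_six_mul_real_hitAt p m)

/-- **Smallness of hit probabilities along ANY sequence of heights is already the conjunct**: if
`P_{p_c}(m_k e₀ ↔ plane) → 0` for some sequence of heights `m_k`, then `θ(p_c) = 0`. [folklore] -/
theorem summit_of_hitProb_tendsto_zero {m : ℕ → ℕ}
    (h : Tendsto (fun k => μc.real (hitAt (m k))) atTop (𝓝 0)) : _root_.PercolationContinuityZ3 := by
  rw [summit_iff]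
  refine le_antisymm ?_ (by unfold theta; exact measureReal_nonneg)
  have h6 : Tendsto (fun k => 6 * μc.real (hitAt (m k))) atTop (𝓝 0) := by
    simpa using h.const_mul 6
  exact ge_of_tendsto' h6 fun k => theta_le_six_mul_real_hitAt (criticalProbI 3) (m k)

/-! ## §2 The candidate pieces (typed) -/

/-- D1 piece: the cap event has POSITIVE probability at `p_c`. [folklore] -/
def PosProbCap : Prop := 0 < μc {ω | (hitSet ω).Finite}

/-- D1 piece: zero–one law for the cap event at `(3, p_c)` (instance of the route's support item
`CapZeroOne`). [folklore] -/
def CapZeroOneZ3 : Prop := μc {ω | (hitSet ω).Finite} = 0 ∨ μc {ω | (hitSet ω).Finite} = 1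

/-- D2 piece: first moment — the hit probabilities are summable (`E #hits < ∞`). [folklore] -/
def HitProbSummable : Prop := Summable fun t : ℕ => μc.real (hitAt t)

/-- D3 piece: the critical one-arm probabilities of `ℤ³` are summable. [folklore] -/
def OneArmSummableZ3 : Prop := Summable fun n : ℕ => oneArmProb 3 (criticalProbI 3) n

/-- The dyadic block hit event `H_k = ⋃_{2^k ≤ t < 2^{k+1}} {t e₀ ↔ plane}`. [folklore] -/
def blockHit (k : ℕ) : Set (BondConfig (Site 3)) := ⋃ t ∈ Set.Ico ((2 : ℤ) ^ k) (2 ^ (k + 1)), hitAt t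

/-- D4 piece: dyadic Borel–Cantelli — the block hit probabilities are summable. [folklore] -/
def DyadicHitSummable : Prop := Summable fun k : ℕ => μc.real (blockHit k)

/-- D5 piece (low excursions): a.s. finitely many heights `t` are joined to the plane by an open path
staying strictly below height `2t`. [folklore] -/
def CapLow : Prop :=
  ∀ᵐ ω ∂μc, Set.Finite {t : ℤ | 0 < t ∧ ∃ y : Site 3, y 0 = 0 ∧
    ω ∈ openConnIn {x : Site 3 | x 0 < 2 * t} (Pi.single 0 t : Site 3) y}

/-- D5 piece (high excursions): a.s. finitely many heights `t` are hits NOT realisable below height `2t`.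
[folklore] -/
def CapHigh : Prop :=
  ∀ᵐ ω ∂μc, Set.Finite {t : ℤ | 0 < t ∧ ω ∈ hitAt t ∧ ¬ ∃ y : Site 3, y 0 = 0 ∧
    ω ∈ openConnIn {x : Site 3 | x 0 < 2 * t} (Pi.single 0 t : Site 3) y}

/-- D6 piece: a.s. finitely many run-ends (`t` a hit, `t + 1` not). [folklore] -/
def RunEndsFinite : Prop := ∀ᵐ ω ∂μc, Set.Finite {t : ℤ | 0 < t ∧ ω ∈ hitAt t ∧ ω ∉ hitAt (t + 1)}

/-- D6 piece: a.s. no infinite run of hits (above every height there is a non-hit). [folklore] -/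
def NoInfiniteRun : Prop := ∀ᵐ ω ∂μc, ∀ T : ℤ, ∃ t, T < t ∧ ω ∉ hitAt t

/-- D7 piece: caps strictly below `p_c` on `ℤ³` (instance of the route's support item `CapBelowCritical`).
[folklore] -/
def CapBelowZ3 : Prop :=
  ∀ p : unitInterval, (p : ℝ) < criticalProb (zdGraph 3) (0 : Site 3) →
    ∀ᵐ ω ∂(bondPercolation (zdGraph 3) p), (hitSet ω).Finite

/-- D7 piece: "left-continuity of the cap property at `p_c`". [folklore] -/
def CapLeftContinuous : Prop := CapBelowZ3 → Theses.PercCriticalCaps.CapAtCriticality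

/-- The bridging components of `ω`: open clusters meeting both the positive axis and the plane.
[folklore] -/
def bridging (ω : BondConfig (Site 3)) : Set (openGraph ω).ConnectedComponent :=
  {C | (∃ t : ℤ, 0 < t ∧ (openGraph ω).connectedComponentMk (Pi.single 0 t : Site 3) = C) ∧
    ∃ y : Site 3, y 0 = 0 ∧ (openGraph ω).connectedComponentMk y = C}

/-- D8 piece: a.s. finitely many bridging clusters. [folklore] -/
def FinBridging : Prop := ∀ᵐ ω ∂μc, (bridging ω).Finite

/-- D8 piece: a.s. every hit lies in a FINITE cluster (no infinite bridging cluster). [folklore] -/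
def NoInfiniteBridging : Prop :=
  ∀ᵐ ω ∂μc, ∀ t : ℤ, 0 < t → ω ∈ hitAt t → (openCluster ω (Pi.single 0 t : Site 3)).Finite

/-! ## §3 Criterion (c) fails for every smallness piece: each implies the conjunct -/

/-- D2's piece is summit-or-harder: `HitProbSummable → θ(p_c) = 0`. [folklore] -/
theorem summit_of_hitProbSummable (h : HitProbSummable) : _root_.PercolationContinuityZ3 :=
  summit_of_hitProb_tendsto_zero (m := fun k => k) h.tendsto_atTop_zero

/-- D3's piece is summit-or-harder: `OneArmSummableZ3 → θ(p_c) = 0`. [folklore] -/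
theorem summit_of_oneArmSummableZ3 (h : OneArmSummableZ3) : _root_.PercolationContinuityZ3 := by
  rw [summit_iff]
  refine le_antisymm ?_ (by unfold theta; exact measureReal_nonneg)
  exact ge_of_tendsto' h.tendsto_atTop_zero fun n => DCT16.theta_le_real_siteToBoundary (criticalProbI 3) n

/-- `2^k` lies in the `k`-th dyadic block, so `P(hit at 2^k) ≤ P(H_k)`. [folklore] -/
theorem real_hitAt_pow_le_real_blockHit (k : ℕ) :
    μc.real (hitAt ((2 : ℕ) ^ k : ℕ)) ≤ μc.real (blockHit k) := by
  refine measureReal_mono ?_ (measure_ne_top _ _)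
  intro ω hω
  have hω' : ω ∈ hitAt ((2 : ℤ) ^ k) := by simpa using hω
  have hlt : (2 : ℤ) ^ k < 2 ^ (k + 1) := by
    rw [pow_succ]; linarith [pow_pos (show (0 : ℤ) < 2 by norm_num) k]
  exact Set.mem_biUnion (show (2 : ℤ) ^ k ∈ Set.Ico ((2 : ℤ) ^ k) (2 ^ (k + 1)) from ⟨le_rfl, hlt⟩) hω'

/-- D4's piece is summit-or-harder: `DyadicHitSummable → θ(p_c) = 0`. [folklore] -/
theorem summit_of_dyadicHitSummable (h : DyadicHitSummable) : _root_.PercolationContinuityZ3 := by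
  refine summit_of_hitProb_tendsto_zero (m := fun k => 2 ^ k) ?_
  refine squeeze_zero (fun k => measureReal_nonneg) (fun k => real_hitAt_pow_le_real_blockHit k) ?_
  exact h.tendsto_atTop_zero

/-! ## §4 The first-moment engines are dead on `ℤ³` (pieces rigorously false) -/

/-- **`Σ_t P_{p_c}(t e₀ ↔ plane) = ∞` on `ℤ³`** (`E_{p_c} #hits = ∞`): D2's piece is FALSE. [folklore] -/
theorem not_hitProbSummable : ¬ HitProbSummable := by
  intro hs
  obtain ⟨c, hc, hπ⟩ := exists_oneArmProb_criticalProbI_three_lower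
  -- `c / (6 t) ≤ P(hit at t)` for all `t` (trivial at `t = 0`)
  have hle : ∀ t : ℕ, c / 6 * (1 / (t : ℝ)) ≤ μc.real (hitAt t) := by
    intro t
    rcases Nat.eq_zero_or_pos t with rfl | ht
    · simp [measureReal_nonneg]
    · have h1 := hπ t ht
      have h2 := oneArmProb_le_six_mul_real_hitAt (criticalProbI 3) t
      have ht' : (0 : ℝ) < t := by exact_mod_cast ht
      rw [div_le_iff₀ ht'] at h1
      have h3 : oneArmProb 3 (criticalProbI 3) t * t ≤ 6 * μc.real (hitAt t) * t :=
        mul_le_mul_of_nonneg_right h2 ht'.le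
      have : c / 6 * (1 / (t : ℝ)) = c / t / 6 := by ring
      rw [this, div_le_iff₀ (by norm_num : (0 : ℝ) < 6), div_le_iff₀ ht']
      linarith
  have hsum : Summable fun t : ℕ => c / 6 * (1 / (t : ℝ)) :=
    Summable.of_nonneg_of_le (fun t => by positivity) hle hs
  have : Summable fun t : ℕ => 1 / (t : ℝ) :=
    (summable_mul_left_iff (ne_of_gt (by positivity : (0 : ℝ) < c / 6))).1 hsum
  exact Real.not_summable_one_div_natCast this

/-- **`Σ_n π_{p_c}(n) = ∞` on `ℤ³`**: D3's piece is FALSE, i.e. the route's only engine for the crux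
(`SummableOneArmGivesCap`) never fires in `d = 3`. [folklore] -/
theorem not_oneArmSummableZ3 : ¬ OneArmSummableZ3 := by
  intro hs
  obtain ⟨c, hc, hπ⟩ := exists_oneArmProb_criticalProbI_three_lower
  have hle : ∀ n : ℕ, c * (1 / (n : ℝ)) ≤ oneArmProb 3 (criticalProbI 3) n := by
    intro n
    rcases Nat.eq_zero_or_pos n with rfl | hn
    · simp [oneArmProb, measureReal_nonneg]
    · have := hπ n hn
      rwa [div_eq_mul_one_div] at this
  have hsum : Summable fun n : ℕ => c * (1 / (n : ℝ)) :=
    Summable.of_nonneg_of_le (fun n => by positivity) hle hs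
  exact Real.not_summable_one_div_natCast ((summable_mul_left_iff (ne_of_gt hc)).1 hsum)

/-! ## §5 The seams (assemblies) of the non-smallness splits, proved to exhibit their thinness -/

/-- D5 assembly (partition of the hit set by excursion height): eight lines of set algebra — a trivial
seam, `Cap = CapLow ∧ CapHigh` by construction. [folklore] -/
theorem cap_of_capLow_of_capHigh (h₁ : CapLow) (h₂ : CapHigh) :
    Theses.PercCriticalCaps.CapAtCriticality := by
  rw [cap_iff]
  filter_upwards [h₁, h₂] with ω hlo hhi
  refine (hlo.union hhi).subset ?_
  rintro t ⟨ht, hhit⟩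
  by_cases h : ∃ y : Site 3, y 0 = 0 ∧
      ω ∈ openConnIn {x : Site 3 | x 0 < 2 * t} (Pi.single 0 t : Site 3) y
  · exact Or.inl ⟨ht, h⟩
  · exact Or.inr ⟨ht, hhit, h⟩

/-- The hit event is measurable. [folklore] -/
theorem measurableSet_hitAt (t : ℤ) : MeasurableSet (hitAt t) := by
  have : hitAt t = ⋃ y ∈ {y : Site 3 | y 0 = 0}, openConn (Pi.single 0 t : Site 3) y := by
    ext ω; simp [hitAt]
  rw [this]
  exact MeasurableSet.biUnion (Set.to_countable _) fun y _ => measurableSet_openConn_holds _ _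

/-- The hit set is finite iff it is bounded: `{finite} = ⋃_T ⋂_t {T < t → no hit at t}`. [folklore] -/
theorem setOf_finite_hitSet_eq :
    {ω | (hitSet ω).Finite} = ⋃ T : ℕ, ⋂ t : ℤ, {ω | (T : ℤ) < t → ω ∉ hitAt t} := by
  ext ω
  simp only [Set.mem_setOf_eq, Set.mem_iUnion, Set.mem_iInter]
  constructor
  · intro hfin
    obtain ⟨B, hB⟩ := hfin.bddAbove
    refine ⟨B.toNat, fun t ht hhit => ?_⟩
    have h3 : (B : ℤ) ≤ B.toNat := Int.self_le_toNat B
    have h0 : (0 : ℤ) ≤ (B.toNat : ℤ) := by positivity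
    have h2 : t ≤ B := hB ⟨by omega, hhit⟩
    omega
  · rintro ⟨T, hT⟩
    refine (Set.finite_Ioc (0 : ℤ) T).subset ?_
    rintro t ⟨ht, hhit⟩
    refine ⟨ht, ?_⟩
    by_contra hle
    exact hT t (not_le.1 hle) hhit

/-- The cap event is measurable. [folklore] -/
theorem measurableSet_finite_hitSet : MeasurableSet {ω | (hitSet ω).Finite} := by
  rw [setOf_finite_hitSet_eq]
  refine MeasurableSet.iUnion fun T => MeasurableSet.iInter fun t => ?_
  by_cases h : (T : ℤ) < t
  · have : {ω : BondConfig (Site 3) | (T : ℤ) < t → ω ∉ hitAt t} = (hitAt t)ᶜ := by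
      ext ω; simp [h]
    rw [this]; exact (measurableSet_hitAt t).compl
  · have : {ω : BondConfig (Site 3) | (T : ℤ) < t → ω ∉ hitAt t} = Set.univ := by
      ext ω; simp [h]
    rw [this]; exact MeasurableSet.univ

/-- D1 assembly (zero–one law + positive probability): ten lines of measure theory — the seam is the
PROVABLE zero–one law, so the open piece `PosProbCap` is the crux up to a support item. [folklore] -/
theorem cap_of_posProb_of_zeroOne (h₁ : PosProbCap) (h₂ : CapZeroOneZ3) :
    Theses.PercCriticalCaps.CapAtCriticality := by
  rw [cap_iff, ae_iff]
  have h1 : μc {ω | (hitSet ω).Finite} = 1 := h₂.resolve_left (ne_of_gt h₁)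
  have : {ω | ¬ (hitSet ω).Finite} = {ω | (hitSet ω).Finite}ᶜ := rfl
  rw [this]
  exact (prob_compl_eq_zero_iff measurableSet_finite_hitSet).2 h1

/-- D6 assembly (finitely many run-ends + no infinite run ⇒ finitely many hits): a genuine but small
combinatorial lemma on subsets of `ℤ`; its second input is provable now (isolated axis vertices), so the
open content sits entirely in `RunEndsFinite`. [folklore] -/
theorem cap_of_runEndsFinite_of_noInfiniteRun (h₁ : RunEndsFinite) (h₂ : NoInfiniteRun) :
    Theses.PercCriticalCaps.CapAtCriticality := by
  rw [cap_iff]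
  filter_upwards [h₁, h₂] with ω hR hN
  obtain ⟨M, hM⟩ := hR.bddAbove
  -- every hit lies in `(0, max M 0]`
  refine (Set.finite_Ioc (0 : ℤ) (max M 0)).subset ?_
  rintro t ⟨ht, hhit⟩
  refine ⟨ht, ?_⟩
  by_contra hgt
  push_neg at hgt
  have hMt : M < t := lt_of_le_of_lt (le_max_left M 0) hgt
  -- a non-hit above `t`, at height `t + 1 + n` for some `n : ℕ`
  obtain ⟨s, hs, hsn⟩ := hN t
  have hex : ∃ n : ℕ, ω ∉ hitAt (t + 1 + n) := by
    refine ⟨(s - t - 1).toNat, ?_⟩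
    have : t + 1 + ((s - t - 1).toNat : ℤ) = s := by
      rw [Int.toNat_of_nonneg (by omega)]; ring
    rw [this]; exact hsn
  classical
  -- the least such `n`
  obtain ⟨n₀, hn₀, hmin⟩ : ∃ n₀ : ℕ, ω ∉ hitAt (t + 1 + n₀) ∧ ∀ m, m < n₀ → ω ∈ hitAt (t + 1 + m) :=
    ⟨Nat.find hex, Nat.find_spec hex, fun m hm => not_not.1 (Nat.find_min hex hm)⟩
  have hprev : ω ∈ hitAt (t + n₀) := by
    rcases Nat.eq_zero_or_pos n₀ with h0 | hpos
    · subst h0; simpa using hhit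
    · have h := hmin (n₀ - 1) (by omega)
      have hc : t + 1 + ((n₀ - 1 : ℕ) : ℤ) = t + n₀ := by
        rw [Nat.cast_sub hpos]; push_cast; ring
      rwa [hc] at h
  have hend : t + (n₀ : ℤ) ∈ {t : ℤ | 0 < t ∧ ω ∈ hitAt t ∧ ω ∉ hitAt (t + 1)} :=
    ⟨by omega, hprev, by rwa [show t + (n₀ : ℤ) + 1 = t + 1 + n₀ by ring]⟩
  have hle : t + (n₀ : ℤ) ≤ M := hM hend
  omega

/-- D8 assembly (finitely many bridging clusters, each hit in a finite cluster ⇒ finitely many hits):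
a finite union of finite fibres. [folklore] -/
theorem cap_of_finBridging_of_noInfiniteBridging (h₁ : FinBridging) (h₂ : NoInfiniteBridging) :
    Theses.PercCriticalCaps.CapAtCriticality := by
  rw [cap_iff]
  filter_upwards [h₁, h₂] with ω hF hN
  set f : ℤ → (openGraph ω).ConnectedComponent :=
    fun t => (openGraph ω).connectedComponentMk (Pi.single 0 t : Site 3) with hf
  have hcover : hitSet ω ⊆ ⋃ C ∈ bridging ω, {t | t ∈ hitSet ω ∧ f t = C} := by
    intro t ht
    obtain ⟨ht0, y, hy0, hconn⟩ := ht
    have hC : f t ∈ bridging ω :=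
      ⟨⟨t, ht0, rfl⟩, y, hy0, SimpleGraph.ConnectedComponent.eq.2 hconn.symm⟩
    exact Set.mem_biUnion hC ⟨⟨ht0, y, hy0, hconn⟩, rfl⟩
  refine (hF.biUnion fun C _ => ?_).subset hcover
  by_cases hne : ∃ t₀, t₀ ∈ hitSet ω ∧ f t₀ = C
  · obtain ⟨t₀, ht₀, hft₀⟩ := hne
    have hfinC : (openCluster ω (Pi.single 0 t₀ : Site 3)).Finite := hN t₀ ht₀.1 ht₀.2
    have himage : (fun t : ℤ => (Pi.single 0 t : Site 3)) '' {t | t ∈ hitSet ω ∧ f t = C} ⊆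
        openCluster ω (Pi.single 0 t₀ : Site 3) := by
      rintro _ ⟨t, ⟨-, hft⟩, rfl⟩
      have h : f t₀ = f t := hft₀.trans hft.symm
      exact SimpleGraph.ConnectedComponent.eq.1 h
    refine Set.Finite.of_finite_image (hfinC.subset himage) ?_
    intro a _ b _ hab
    have := congrFun hab 0
    simpa using this
  · push_neg at hne
    exact Set.finite_empty.subset fun t ht => (hne t ht.1 ht.2).elim

end Summit.CriticalPhenomena.PercolationContinuityZ3.Cruxes.CapAtCriticality.Census

end
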